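import Summits.CriticalPhenomena.PercolationContinuityZ3.Theorems.SahiBoxTP2HolleyCube

/-!
# Holley's inequality for two measures, density-free: the cross box condition
# `μ₁[a,b] μ₂[a',b'] ≤ μ₁[a ∧ a', b ∧ b'] μ₂[a ∨ a', b ∨ b']` implies `μ₁/Z₁ ≤_st μ₂/Z₂` on `[0,1]^d`

Support file of the Sahi cell (`prim-sahi`, typer seat, generation 15; `--supports stmt-CriticalPhenomena-4575`).
Theorems only (no definitions, no named facts, no sorries).

Holley (1974): for strictly positive weights on a finite distributive lattice, `μ₁(x ∧ y) μ₂(x ∨ y) ≥ μ₁(x) μ₂(y)`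
implies `μ₁ ≤_st μ₂` (Mathlib `holley`; tree `HolleyCriterion.lean`); Preston (1974) proved the continuous version
for DENSITIES with respect to a product reference measure.  Here is the DENSITY-FREE version for arbitrary
(singular) finite measures on the cube, the box form of the hypothesis replacing the pointwise one:

* `fourFunctions_of_fiber₂` — the two-measure form of the density-free four functions theorem of
  `SahiBoxTP2FourFunctions.lean` (discretisation scheme `φ_n` of measurable lattice homomorphisms with finite
  ranges; CROSS fibre condition `μ₁(φ⁻¹a) μ₂(φ⁻¹b) ≤ μ₁(φ⁻¹(a ∧ b)) μ₂(φ⁻¹(a ∨ b))`; conclusion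
  `(∫f₀ dμ₁)(∫f₁ dμ₂) ≤ (∫f₂ dμ₁)(∫f₃ dμ₂)` for regular `f` with `f₀(x)f₁(y) ≤ f₂(x ∧ y)f₃(x ∨ y)`).
* `measure_mul_le_of_monotone_iUnion₂`, `crossCell_of_crossBox` — on `Q_d` the cross BOX condition gives the cross
  CELL condition for every grid (cells are increasing unions of closed boxes).
* `holley_lowerSet_of_crossBox_cube`, `holley_upperSet_of_crossBox_cube` — **for finite measures `μ₁, μ₂` on
  `[0,1]^d` with the cross box condition and EVERY measurable up-set `U`: `μ₁(U) μ₂(Q_d) ≤ μ₁(Q_d) μ₂(U)`**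
  (closed down-sets by the lower-corner scheme, then inner regularity);
* `holley_integral_of_crossBox_cube` — `(∫ h dμ₁) μ₂(Q_d) ≤ μ₁(Q_d) (∫ h dμ₂)` for every bounded measurable
  increasing `h`; `holley_of_crossBox_cube` — **HOLLEY'S INEQUALITY, DENSITY-FREE: for probability measures,
  `∫ h dμ₁ ≤ ∫ h dμ₂`.**

No sorries, no new axioms.
-/

noncomputable section

namespace Summit.CriticalPhenomena.PercolationContinuityZ3.Theorems.SahiBoxTP2

open MeasureTheory Set Filter Topology Function
open Literature.Combinatorics.Sahi2008 Literature.Combinatorics.Sahi2008.LebesgueSquare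
open Literature.Combinatorics.Sahi2008.LebesgueCube SahiCubeDensity
open scoped ENNReal unitInterval

/-! ### The two-measure density-free four functions theorem -/

section TwoMeasures

variable {X : Type*} [MeasurableSpace X] [MeasurableSingletonClass X] [DistribLattice X]

/-- **Two-measure four functions inequality at one discretisation level** (cross fibre condition). [this work] -/
theorem fourFunctions_comp_of_fiber₂ (μ₁ μ₂ : Measure X) [IsFiniteMeasure μ₁] [IsFiniteMeasure μ₂] {φ : X → X}
    (hφ : Measurable φ) (hinf : ∀ x y, φ (x ⊓ y) = φ x ⊓ φ y) (hsup : ∀ x y, φ (x ⊔ y) = φ x ⊔ φ y)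
    (hfin : (range φ).Finite)
    (hw : ∀ a b, μ₁ (φ ⁻¹' {a}) * μ₂ (φ ⁻¹' {b}) ≤ μ₁ (φ ⁻¹' {a ⊓ b}) * μ₂ (φ ⁻¹' {a ⊔ b}))
    (f : Fin 4 → X → ℝ) (hf0 : ∀ j x, 0 ≤ f j x) (h : ∀ x y, f 0 x * f 1 y ≤ f 2 (x ⊓ y) * f 3 (x ⊔ y)) :
    (∫ x, f 0 (φ x) ∂μ₁) * (∫ x, f 1 (φ x) ∂μ₂) ≤ (∫ x, f 2 (φ x) ∂μ₁) * (∫ x, f 3 (φ x) ∂μ₂) := by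
  classical
  set s := hfin.toFinset with hs
  have hmem : ∀ x, φ x ∈ s := fun x => hfin.mem_toFinset.2 (mem_range_self x)
  have hsc : InfClosed (s : Set X) := by
    rw [hs, hfin.coe_toFinset]
    rintro _ ⟨x, rfl⟩ _ ⟨y, rfl⟩
    exact ⟨x ⊓ y, hinf x y⟩
  have hsc' : SupClosed (s : Set X) := by
    rw [hs, hfin.coe_toFinset]
    rintro _ ⟨x, rfl⟩ _ ⟨y, rfl⟩
    exact ⟨x ⊔ y, hsup x y⟩
  have hsinf := (Finset.infs_self (s := s)).2 hsc
  have hssup := (Finset.sups_eq_self (s := s)).2 hsc'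
  simp only [integral_comp_eq_sum_measureReal μ₁ hφ s hmem, integral_comp_eq_sum_measureReal μ₂ hφ s hmem]
  set w₁ : X → ℝ := fun q => μ₁.real (φ ⁻¹' {q}) with hw₁
  set w₂ : X → ℝ := fun q => μ₂.real (φ ⁻¹' {q}) with hw₂
  have hw₁0 : ∀ q, 0 ≤ w₁ q := fun q => measureReal_nonneg
  have hw₂0 : ∀ q, 0 ≤ w₂ q := fun q => measureReal_nonneg
  have hw' : ∀ a b, w₁ a * w₂ b ≤ w₁ (a ⊓ b) * w₂ (a ⊔ b) := fun a b => by
    simp only [hw₁, hw₂, measureReal_def, ← ENNReal.toReal_mul]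
    exact ENNReal.toReal_mono (ENNReal.mul_ne_top (measure_ne_top _ _) (measure_ne_top _ _)) (hw a b)
  have key := four_functions_theorem (fun q => w₁ q * f 0 q) (fun q => w₂ q * f 1 q) (fun q => w₁ q * f 2 q)
    (fun q => w₂ q * f 3 q) (fun q => mul_nonneg (hw₁0 q) (hf0 0 q)) (fun q => mul_nonneg (hw₂0 q) (hf0 1 q))
    (fun q => mul_nonneg (hw₁0 q) (hf0 2 q)) (fun q => mul_nonneg (hw₂0 q) (hf0 3 q)) (fun a b => ?_) s s
  · rwa [hsinf, hssup] at key
  · calc w₁ a * f 0 a * (w₂ b * f 1 b) = (w₁ a * w₂ b) * (f 0 a * f 1 b) := mul_mul_mul_comm _ _ _ _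
      _ ≤ (w₁ (a ⊓ b) * w₂ (a ⊔ b)) * (f 2 (a ⊓ b) * f 3 (a ⊔ b)) :=
          mul_le_mul (hw' a b) (h a b) (mul_nonneg (hf0 0 a) (hf0 1 b)) (mul_nonneg (hw₁0 _) (hw₂0 _))
      _ = w₁ (a ⊓ b) * f 2 (a ⊓ b) * (w₂ (a ⊔ b) * f 3 (a ⊔ b)) := mul_mul_mul_comm _ _ _ _

/-- **THE TWO-MEASURE DENSITY-FREE FOUR FUNCTIONS THEOREM**: `μ₁, μ₂` finite, `φ_n` measurable lattice
homomorphisms with finite ranges and the CROSS fibre condition; `f₀,…,f₃ ≥ 0` bounded measurable with `f₀, f₂`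
regular along `φ` `μ₁`-a.e. and `f₁, f₃` regular `μ₂`-a.e., and `f₀(x)f₁(y) ≤ f₂(x ∧ y)f₃(x ∨ y)`.  Then
`(∫f₀ dμ₁)(∫f₁ dμ₂) ≤ (∫f₂ dμ₁)(∫f₃ dμ₂)`. [this work] -/
theorem fourFunctions_of_fiber₂ (μ₁ μ₂ : Measure X) [IsFiniteMeasure μ₁] [IsFiniteMeasure μ₂] (φ : ℕ → X → X)
    (hφ : ∀ n, Measurable (φ n)) (hinf : ∀ n x y, φ n (x ⊓ y) = φ n x ⊓ φ n y)
    (hsup : ∀ n x y, φ n (x ⊔ y) = φ n x ⊔ φ n y) (hfin : ∀ n, (range (φ n)).Finite)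
    (hw : ∀ n a b, μ₁ (φ n ⁻¹' {a}) * μ₂ (φ n ⁻¹' {b}) ≤ μ₁ (φ n ⁻¹' {a ⊓ b}) * μ₂ (φ n ⁻¹' {a ⊔ b}))
    (f : Fin 4 → X → ℝ) (hf0 : ∀ j x, 0 ≤ f j x) (hfm : ∀ j, Measurable (f j)) {C : ℝ} (hfC : ∀ j x, f j x ≤ C)
    (hreg₀ : ∀ᵐ x ∂μ₁, Tendsto (fun n => f 0 (φ n x)) atTop (𝓝 (f 0 x)))
    (hreg₁ : ∀ᵐ x ∂μ₂, Tendsto (fun n => f 1 (φ n x)) atTop (𝓝 (f 1 x)))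
    (hreg₂ : ∀ᵐ x ∂μ₁, Tendsto (fun n => f 2 (φ n x)) atTop (𝓝 (f 2 x)))
    (hreg₃ : ∀ᵐ x ∂μ₂, Tendsto (fun n => f 3 (φ n x)) atTop (𝓝 (f 3 x)))
    (h : ∀ x y, f 0 x * f 1 y ≤ f 2 (x ⊓ y) * f 3 (x ⊔ y)) :
    (∫ x, f 0 x ∂μ₁) * (∫ x, f 1 x ∂μ₂) ≤ (∫ x, f 2 x ∂μ₁) * (∫ x, f 3 x ∂μ₂) := by
  have hlim : ∀ (ν : Measure X) [IsFiniteMeasure ν] (j : Fin 4),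
      (∀ᵐ x ∂ν, Tendsto (fun n => f j (φ n x)) atTop (𝓝 (f j x))) →
      Tendsto (fun n => ∫ x, f j (φ n x) ∂ν) atTop (𝓝 (∫ x, f j x ∂ν)) := by
    intro ν _ j hreg
    refine tendsto_integral_of_dominated_convergence (fun _ => C) (fun n => ?_) (integrable_const C)
      (fun n => Eventually.of_forall fun x => ?_) hreg
    · exact ((hfm j).comp (hφ n)).aestronglyMeasurable
    · rw [Real.norm_eq_abs, abs_of_nonneg (hf0 j _)]
      exact hfC j _
  exact le_of_tendsto_of_tendsto' ((hlim μ₁ 0 hreg₀).mul (hlim μ₂ 1 hreg₁))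
    ((hlim μ₁ 2 hreg₂).mul (hlim μ₂ 3 hreg₃)) fun n =>
    fourFunctions_comp_of_fiber₂ μ₁ μ₂ (hφ n) (hinf n) (hsup n) (hfin n) (hw n) f hf0 h

end TwoMeasures

/-! ### The cube: cross box condition ⇒ cross cell condition ⇒ Holley -/

section Cube

variable {d : ℕ}

/-- Passing to increasing unions in `μ₁(A)μ₂(B) ≤ μ₁(C)μ₂(D)`. [folklore] -/
theorem measure_mul_le_of_monotone_iUnion₂ {Ω : Type*} [MeasurableSpace Ω] (μ₁ μ₂ : Measure Ω)
    {A B C D : ℕ → Set Ω} (hA : Monotone A) (hB : Monotone B) (hC : Monotone C) (hD : Monotone D)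
    (h : ∀ k, μ₁ (A k) * μ₂ (B k) ≤ μ₁ (C k) * μ₂ (D k)) :
    μ₁ (⋃ k, A k) * μ₂ (⋃ k, B k) ≤ μ₁ (⋃ k, C k) * μ₂ (⋃ k, D k) := by
  rw [hA.measure_iUnion, hB.measure_iUnion, hC.measure_iUnion, hD.measure_iUnion, ENNReal.iSup_mul]
  refine iSup_le fun k => ?_
  rw [ENNReal.mul_iSup]
  refine iSup_le fun l => ?_
  calc μ₁ (A k) * μ₂ (B l) ≤ μ₁ (A (max k l)) * μ₂ (B (max k l)) :=
        mul_le_mul' (measure_mono (hA (le_max_left k l))) (measure_mono (hB (le_max_right k l)))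
    _ ≤ μ₁ (C (max k l)) * μ₂ (D (max k l)) := h _
    _ ≤ (⨆ i, μ₁ (C i)) * ⨆ i, μ₂ (D i) :=
        mul_le_mul' (le_iSup (fun i => μ₁ (C i)) _) (le_iSup (fun i => μ₂ (D i)) _)

/-- **Cross box condition ⇒ cross cell condition** on every grid of `Q_d` (cells are increasing unions of closed
boxes with lattice-homomorphic corners). [this work] -/
theorem crossCell_of_crossBox (μ₁ μ₂ : Measure (Fin d → I))
    (hcross : ∀ a b a' b' : Fin d → I,
      μ₁ (Icc a b) * μ₂ (Icc a' b') ≤ μ₁ (Icc (a ⊓ a') (b ⊓ b')) * μ₂ (Icc (a ⊔ a') (b ⊔ b')))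
    (m : ℕ) (c c' : Fin d → Fin (m + 1)) :
    μ₁ (cubeCell m ⁻¹' {c}) * μ₂ (cubeCell m ⁻¹' {c'}) ≤
      μ₁ (cubeCell m ⁻¹' {c ⊓ c'}) * μ₂ (cubeCell m ⁻¹' {c ⊔ c'}) := by
  rw [cubeCell_preimage_singleton_eq_iUnion, cubeCell_preimage_singleton_eq_iUnion,
    cubeCell_preimage_singleton_eq_iUnion, cubeCell_preimage_singleton_eq_iUnion]
  refine measure_mul_le_of_monotone_iUnion₂ μ₁ μ₂ (monotone_cellBox c) (monotone_cellBox c')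
    (monotone_cellBox _) (monotone_cellBox _) fun k => ?_
  have h := hcross (cellLoCorner m c) (cellHiCorner m k c) (cellLoCorner m c') (cellHiCorner m k c')
  rwa [← cellLoCorner_inf, ← cellHiCorner_inf, ← cellLoCorner_sup, ← cellHiCorner_sup] at h

/-- The cross fibre condition for the lower-corner scheme. [this work] -/
theorem crossFiber_loCornerCell_of_crossBox (μ₁ μ₂ : Measure (Fin d → I))
    (hcross : ∀ a b a' b' : Fin d → I,
      μ₁ (Icc a b) * μ₂ (Icc a' b') ≤ μ₁ (Icc (a ⊓ a') (b ⊓ b')) * μ₂ (Icc (a ⊔ a') (b ⊔ b')))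
    (m : ℕ) (a b : Fin d → I) :
    μ₁ ((fun x : Fin d → I => cellLoCorner m (cubeCell m x)) ⁻¹' {a}) *
        μ₂ ((fun x : Fin d → I => cellLoCorner m (cubeCell m x)) ⁻¹' {b}) ≤
      μ₁ ((fun x : Fin d → I => cellLoCorner m (cubeCell m x)) ⁻¹' {a ⊓ b}) *
        μ₂ ((fun x : Fin d → I => cellLoCorner m (cubeCell m x)) ⁻¹' {a ⊔ b}) := by
  by_cases ha : cellLoCorner m (cubeCell m a) = a
  · by_cases hb : cellLoCorner m (cubeCell m b) = b
    · have hab : cellLoCorner m (cubeCell m (a ⊓ b)) = a ⊓ b := by rw [loCornerCell_inf, ha, hb]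
      have hab' : cellLoCorner m (cubeCell m (a ⊔ b)) = a ⊔ b := by rw [loCornerCell_sup, ha, hb]
      rw [preimage_loCornerCell_singleton_of_eq m ha, preimage_loCornerCell_singleton_of_eq m hb,
        preimage_loCornerCell_singleton_of_eq m hab, preimage_loCornerCell_singleton_of_eq m hab', cubeCell_inf,
        cubeCell_sup]
      exact crossCell_of_crossBox μ₁ μ₂ hcross m _ _
    · rw [preimage_loCornerCell_singleton_of_ne m hb, measure_empty, mul_zero]
      exact zero_le
  · rw [preimage_loCornerCell_singleton_of_ne m ha, measure_empty, zero_mul]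
    exact zero_le

/-- **Cross box condition ⇒ Holley on closed down-sets**: `μ₁(Q_d) μ₂(D) ≤ μ₁(D) μ₂(Q_d)`. [this work] -/
theorem holley_lowerSet_of_crossBox_cube (μ₁ μ₂ : Measure (Fin d → I)) [IsFiniteMeasure μ₁] [IsFiniteMeasure μ₂]
    (hcross : ∀ a b a' b' : Fin d → I,
      μ₁ (Icc a b) * μ₂ (Icc a' b') ≤ μ₁ (Icc (a ⊓ a') (b ⊓ b')) * μ₂ (Icc (a ⊔ a') (b ⊔ b')))
    {D : Set (Fin d → I)} (hDc : IsClosed D) (hD : IsLowerSet D) :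
    μ₁.real univ * μ₂.real D ≤ μ₁.real D * μ₂.real univ := by
  classical
  have hDm : MeasurableSet D := hDc.measurableSet
  have hind : ∀ x, 0 ≤ D.indicator (1 : (Fin d → I) → ℝ) x ∧ D.indicator (1 : (Fin d → I) → ℝ) x ≤ 1 := fun x => by
    by_cases hx : x ∈ D
    · simp [indicator_of_mem hx]
    · simp [indicator_of_notMem hx]
  have key := fourFunctions_of_fiber₂ μ₁ μ₂ (fun m x => cellLoCorner m (cubeCell m x)) measurable_loCornerCell
    loCornerCell_inf loCornerCell_sup finite_range_loCornerCell (crossFiber_loCornerCell_of_crossBox μ₁ μ₂ hcross)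
    ![fun _ => 1, D.indicator 1, D.indicator 1, fun _ => 1]
    (fun j x => by
      fin_cases j
      · exact zero_le_one
      · exact (hind x).1
      · exact (hind x).1
      · exact zero_le_one)
    (fun j => by
      fin_cases j
      · exact measurable_const
      · exact measurable_one.indicator hDm
      · exact measurable_one.indicator hDm
      · exact measurable_const)
    (C := 1) (fun j x => by
      fin_cases j
      · exact le_rfl
      · exact (hind x).2
      · exact (hind x).2
      · exact le_rfl)
    (Eventually.of_forall fun x => tendsto_const_nhds)
    (Eventually.of_forall fun x => tendsto_indicator_comp_loCornerCell hDc hD x)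
    (Eventually.of_forall fun x => tendsto_indicator_comp_loCornerCell hDc hD x)
    (Eventually.of_forall fun x => tendsto_const_nhds)
    (fun x y => by
      show (1 : ℝ) * D.indicator 1 y ≤ D.indicator 1 (x ⊓ y) * 1
      by_cases hy : y ∈ D
      · rw [indicator_of_mem hy, indicator_of_mem (hD inf_le_right hy), Pi.one_apply, Pi.one_apply]
      · rw [indicator_of_notMem hy, mul_zero]
        exact mul_nonneg (hind _).1 zero_le_one)
  change (∫ x, (1 : ℝ) ∂μ₁) * (∫ x, D.indicator (1 : (Fin d → I) → ℝ) x ∂μ₂) ≤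
    (∫ x, D.indicator (1 : (Fin d → I) → ℝ) x ∂μ₁) * (∫ x, (1 : ℝ) ∂μ₂) at key
  simpa only [integral_const, smul_eq_mul, mul_one, integral_indicator_one hDm, one_mul] using key

/-- **Cross box condition ⇒ Holley on every measurable up-set**: `μ₁(U) μ₂(Q_d) ≤ μ₁(Q_d) μ₂(U)` (inner
regularity of the complementary down-set under `μ₂` by lower closures of compact sets). [this work] -/
theorem holley_upperSet_of_crossBox_cube (μ₁ μ₂ : Measure (Fin d → I)) [IsFiniteMeasure μ₁] [IsFiniteMeasure μ₂]
    (hcross : ∀ a b a' b' : Fin d → I,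
      μ₁ (Icc a b) * μ₂ (Icc a' b') ≤ μ₁ (Icc (a ⊓ a') (b ⊓ b')) * μ₂ (Icc (a ⊔ a') (b ⊔ b')))
    {U : Set (Fin d → I)} (hU : IsUpperSet U) (hUm : MeasurableSet U) :
    μ₁ U * μ₂ univ ≤ μ₁ univ * μ₂ U := by
  set D := Uᶜ with hDdef
  have hDm : MeasurableSet D := hUm.compl
  have hD : IsLowerSet D := hU.compl
  -- compact inner approximations of `D` under `μ₂`
  have happ : ∀ j : ℕ, ∃ K, K ⊆ D ∧ IsCompact K ∧ μ₂ (D \ K) < ((j : ℝ≥0∞) + 1)⁻¹ := fun j =>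
    hDm.exists_isCompact_sdiff_lt (measure_ne_top μ₂ _)
      (ENNReal.inv_ne_zero.2 (ENNReal.add_ne_top.2 ⟨ENNReal.natCast_ne_top j, ENNReal.one_ne_top⟩))
  choose K hKD hKc hKμ using happ
  set E : ℕ → Set (Fin d → I) := fun j => (lowerClosure (accumulate K j) : Set (Fin d → I)) with hEdef
  have hEc : ∀ j, IsClosed (E j) := fun j =>
    Literature.Probability.Percolation.isClosed_lowerClosure_of_isCompact (isCompact_accumulate hKc j)
  have hEl : ∀ j, IsLowerSet (E j) := fun j => (lowerClosure _).lower
  have hED : ∀ j, E j ⊆ D := fun j x hx => by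
    obtain ⟨a, ha, hxa⟩ := mem_lowerClosure.1 hx
    obtain ⟨i, -, hi⟩ := mem_accumulate.1 ha
    exact hD hxa (hKD i hi)
  have hEmono : Monotone E := fun i j hij x hx => by
    obtain ⟨a, ha, hxa⟩ := mem_lowerClosure.1 hx
    exact mem_lowerClosure.2 ⟨a, monotone_accumulate hij ha, hxa⟩
  have hKE : ∀ j, K j ⊆ E j := fun j => (subset_accumulate (s := K)).trans subset_lowerClosure
  have hnull : μ₂ (D \ ⋃ j, E j) = 0 := by
    by_contra h0
    obtain ⟨N, hN⟩ := ENNReal.exists_inv_nat_lt h0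
    have h1 : μ₂ (D \ ⋃ j, E j) ≤ μ₂ (D \ K N) :=
      measure_mono (sdiff_subset_sdiff_right ((hKE N).trans (subset_iUnion E N)))
    have h2 : ((N : ℝ≥0∞) + 1)⁻¹ ≤ (N : ℝ≥0∞)⁻¹ := ENNReal.inv_le_inv.2 le_self_add
    exact lt_irrefl _ (((hN.trans_le h1).trans (hKμ N)).trans_le h2)
  have hae : (⋃ j, E j : Set (Fin d → I)) =ᵐ[μ₂] D := by
    refine (ae_eq_set).2 ⟨?_, hnull⟩
    rw [sdiff_eq_empty.2 (iUnion_subset hED), measure_empty]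
  -- the down-set inequality in real numbers, by monotone convergence along `E j`
  have hj : ∀ j, μ₁.real univ * μ₂.real (E j) ≤ μ₁.real D * μ₂.real univ := fun j =>
    (holley_lowerSet_of_crossBox_cube μ₁ μ₂ hcross (hEc j) (hEl j)).trans
      (mul_le_mul_of_nonneg_right (measureReal_mono (hED j)) measureReal_nonneg)
  have hlim : Tendsto (fun j => μ₂.real (E j)) atTop (𝓝 (μ₂.real D)) := by
    have h1 : Tendsto (fun j => μ₂ (E j)) atTop (𝓝 (μ₂ (⋃ j, E j))) := tendsto_measure_iUnion_atTop hEmono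
    rw [measure_congr hae] at h1
    exact (ENNReal.tendsto_toReal (measure_ne_top _ _)).comp h1
  have hDineq : μ₁.real univ * μ₂.real D ≤ μ₁.real D * μ₂.real univ :=
    le_of_tendsto' (tendsto_const_nhds.mul hlim) hj
  -- complements
  have e1 : μ₁.real D = μ₁.real univ - μ₁.real U := measureReal_compl hUm
  have e2 : μ₂.real D = μ₂.real univ - μ₂.real U := measureReal_compl hUm
  rw [e1, e2] at hDineq
  have hreal : μ₁.real U * μ₂.real univ ≤ μ₁.real univ * μ₂.real U := by nlinarith [hDineq]
  rw [← ofReal_measureReal (measure_ne_top μ₁ U), ← ofReal_measureReal (measure_ne_top μ₂ univ),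
    ← ofReal_measureReal (measure_ne_top μ₁ univ), ← ofReal_measureReal (measure_ne_top μ₂ U),
    ← ENNReal.ofReal_mul measureReal_nonneg, ← ENNReal.ofReal_mul measureReal_nonneg]
  exact ENNReal.ofReal_le_ofReal hreal

/-- **HOLLEY'S INEQUALITY, DENSITY-FREE, unnormalised**: for finite measures `μ₁, μ₂` on `[0,1]^d` with the cross
box condition, `(∫ h dμ₁) μ₂(Q_d) ≤ μ₁(Q_d) (∫ h dμ₂)` for every bounded measurable increasing `h`. [this work] -/
theorem holley_integral_of_crossBox_cube (μ₁ μ₂ : Measure (Fin d → I)) [IsFiniteMeasure μ₁] [IsFiniteMeasure μ₂]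
    (hcross : ∀ a b a' b' : Fin d → I,
      μ₁ (Icc a b) * μ₂ (Icc a' b') ≤ μ₁ (Icc (a ⊓ a') (b ⊓ b')) * μ₂ (Icc (a ⊔ a') (b ⊔ b')))
    {h : (Fin d → I) → ℝ} (hh : Monotone h) (hhm : Measurable h) {C : ℝ} (hhC : ∀ x, |h x| ≤ C) :
    (∫ x, h x ∂μ₁) * μ₂.real univ ≤ μ₁.real univ * ∫ x, h x ∂μ₂ :=
  integral_mul_le_mul_integral_of_upperSets μ₁ μ₂
    (fun _ hU hUm => holley_upperSet_of_crossBox_cube μ₁ μ₂ hcross hU hUm) hh hhm hhC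

/-- **HOLLEY'S INEQUALITY, DENSITY-FREE**: for PROBABILITY measures `μ₁, μ₂` on `[0,1]^d` (singular allowed) with
`μ₁[a,b] μ₂[a',b'] ≤ μ₁[a ∧ a', b ∧ b'] μ₂[a ∨ a', b ∨ b']` for all closed boxes, `μ₁ ≤_st μ₂`:
`∫ h dμ₁ ≤ ∫ h dμ₂` for every bounded measurable increasing `h`. [this work] -/
theorem holley_of_crossBox_cube (μ₁ μ₂ : Measure (Fin d → I)) [IsProbabilityMeasure μ₁] [IsProbabilityMeasure μ₂]
    (hcross : ∀ a b a' b' : Fin d → I,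
      μ₁ (Icc a b) * μ₂ (Icc a' b') ≤ μ₁ (Icc (a ⊓ a') (b ⊓ b')) * μ₂ (Icc (a ⊔ a') (b ⊔ b')))
    {h : (Fin d → I) → ℝ} (hh : Monotone h) (hhm : Measurable h) {C : ℝ} (hhC : ∀ x, |h x| ≤ C) :
    ∫ x, h x ∂μ₁ ≤ ∫ x, h x ∂μ₂ := by
  simpa only [probReal_univ, mul_one, one_mul] using holley_integral_of_crossBox_cube μ₁ μ₂ hcross hh hhm hhC

/-- **Events form**: `μ₁(U) ≤ μ₂(U)` for every measurable increasing event. [this work] -/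
theorem holley_upperSet_of_crossBox_cube' (μ₁ μ₂ : Measure (Fin d → I)) [IsProbabilityMeasure μ₁]
    [IsProbabilityMeasure μ₂]
    (hcross : ∀ a b a' b' : Fin d → I,
      μ₁ (Icc a b) * μ₂ (Icc a' b') ≤ μ₁ (Icc (a ⊓ a') (b ⊓ b')) * μ₂ (Icc (a ⊔ a') (b ⊔ b')))
    {U : Set (Fin d → I)} (hU : IsUpperSet U) (hUm : MeasurableSet U) : μ₁ U ≤ μ₂ U := by
  simpa only [measure_univ, mul_one, one_mul] using holley_upperSet_of_crossBox_cube μ₁ μ₂ hcross hU hUm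

end Cube

end Summit.CriticalPhenomena.PercolationContinuityZ3.Theorems.SahiBoxTP2
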